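import Literature.NumberTheory.LFunctions.ClassGroupLFunctionExceptionalZeroQuadraticField
import Literature.NumberTheory.LFunctions.HeckeLOneBound
import Literature.NumberTheory.NumberFields.ResidueLowerBoundAllFields
import HarnessLib

/-!
# Effective repulsion of the exceptional zero of a class group `L`-function from `s = 1`:
# `1 − β ≥ c · |d_K|^{−1/n} (log|d_K|)^{−2}` in every degree (Stark's phenomenon)

Topic `Literature/NumberTheory/LFunctions`, namespace `Literature.NumberTheory.LFunctions.NumberField`.
Theorem-only file (no definition, no named fact, no `sorry`), unconditional, EFFECTIVE (no Siegel-type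
ineffectivity enters: the constants come from Montgomery–Vaughan's Theorem 11.4 and the trivial residue bound
`κ_k ≥ c/√|d_k|` for quadratic fields).

Let `K` be a number field of degree `n > 1`, `χ` a real class group character (`χ = 1` included) and
`β` a real zero of `L(s, χ)` in Stark's window `1 − 1/(8·(2n)!·log|d_K|) ≤ β < 1`.  By
`ClassGroupLFunctionExceptionalZeroQuadraticField.lean` (this file re-derives the statement keeping the
quadratic field at hand) `β` is a zero of `L(s, κ)`, `κ` the primitive Kronecker character of a quadratic
field `k` with `|d_k| = M`, `M^n ∣ d_K²`, and `‖L(1, κ)‖ = κ_k ≥ c₂/√M` (class number formula: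
`Quadratic.LFunction_one_eq_dedekindZeta_residue_of_eq`, `exists_residue_ge_div_sqrt_of_finrank_eq 2`).
Montgomery–Vaughan's Theorem 11.4 (11.10) at `s = 1` (tree, PROVED:
`MontgomeryVaughan2007_thm11_4_LOne_exceptional_holds`: `‖L(1,κ)‖ ≤ C₂ (1 − β) (log M)²` when
`β > 1 − c/log 4M`) then gives:

* `exists_dirichletCharacter_realZero_LOne_ge` — the descent statement WITH the bound
  `c₂/√M ≤ ‖L(1, κ)‖` (absolute `c₂ > 0`);
* `classGroupLFunction_one_sub_realZero_ge` — **there is an ABSOLUTE `c > 0` such that for every number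
  field `K` of degree `n > 1`, every real class group character `χ` and every real zero `β` of `L(s, χ)`
  with `1 − 1/(8(2n)! log|d_K|) ≤ β < 1`:  `c · |d_K|^{−1/n} · (log|d_K|)^{−2} ≤ 1 − β`**
  (`√M ≤ |d_K|^{1/n}`, `log M ≤ log|d_K|`);
* `classGroupLFunction_one_sub_realZero_ge'` — for EVERY real zero `β < 1` (no window):
  `min (1/(8(2n)! log|d_K|)) (c |d_K|^{−1/n} (log|d_K|)^{−2}) ≤ 1 − β`.

This is the mechanism of Stark's effective Brauer–Siegel theorem ([Stark1974]; [Murty1999StarkZeros,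
p. 513 (8)–(10)]: `β_K < 1 − c₂ d_F^{−1/2}`, `ρ_K ≥ c₂ d_K^{−1/n_K}` for Galois `K`), here for the class
group `L`-functions of an ARBITRARY number field (Stark's `n!`-window), with a loss of `(log|d_K|)²` from
(11.10); the repulsion IMPROVES with the degree.  The Summits companion `…ResidueStarkEffective.lean` turns it
into `κ_K ≥ c(n) |d_K|^{−1/n} (log|d_K|)^{−3}` for every number field of degree `n`.

IN PRINT (found by the freshness sweep after landing): for a general quadratic Hecke character `ψ` of `k`
this effective repulsion is **Lemma 12 (Stark)** of Cho–Lemke Oliver–Zaman, arXiv:2510.02309 (2025), §5: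
`1 − β_ψ ≫_{[k:ℚ]} (D_k q(ψ))^{−1/(2[k:ℚ])}` (there without the `(log)²` loss, via "Siegel's classical lower
bound `1 − β ≫ |d|^{−1/2}`"); the present file is an independent kernel-checked certification of the
conductor-one (class group) case with the weaker exponent of the logarithm. [ChoLemkeOliverZaman2025]

## References

* P. J. Cho, R. J. Lemke Oliver, A. Zaman, *Effective Brauer–Siegel theorems for Artin L-functions*,
  arXiv:2510.02309 (2025), §5 Lemma 12 (Stark). [ChoLemkeOliverZaman2025]
* H. M. Stark, *Some effective cases of the Brauer–Siegel theorem*, Invent. Math. 23 (1974) 135–152,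
  Thm. 3, Lemma 4, §1. [Stark1974]
* V. Kumar Murty, *Stark zeros in certain towers of fields*, Math. Res. Lett. 6 (1999) 511–519, p. 513
  (7)–(10). [Murty1999StarkZeros]
* H. L. Montgomery, R. C. Vaughan, *Multiplicative Number Theory I*, CUP 2007, Theorem 11.4 (11.10).
  [MontgomeryVaughan2007]
-/

noncomputable section

open scoped NumberField nonZeroDivisors
open Complex NumberField Module

namespace Literature.NumberTheory.QuadraticFields.Quadratic

open Literature.NumberTheory.LFunctions

/-- For a quadratic field `k` and a real zero `β ∈ (0,1)` of `ζ_k`: the primitive Kronecker character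
`κ` mod `M = |d_k| ≥ 3` has `L(β, κ) = 0` and `‖L(1, κ)‖ = κ_k` (class number formula).
[cite: MontgomeryVaughan2007, §10.1 Exercise 26] [cite: NeukirchANT1999, Ch. VII §5 (5.11)] -/
theorem exists_primitive_LFunction_eq_zero_LOne_eq {k : Type*} [Field k] [NumberField k]
    (h2 : finrank ℚ k = 2) {β : ℝ} (h0 : 0 < β) (h1 : β < 1) (hβ : dedekindZetaCont k β = 0) :
    ∃ (M : ℕ) (_ : NeZero M) (κ : DirichletCharacter ℂ M), M = (NumberField.discr k).natAbs ∧ 3 ≤ M ∧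
      κ ≠ 1 ∧ κ ^ 2 = 1 ∧ κ.IsPrimitive ∧ κ.LFunction β = 0 ∧
      ‖κ.LFunction 1‖ = dedekindZeta_residue k := by
  obtain ⟨M, hM0, κ, hM, hκ, hsq, hprim, hfac⟩ := exists_primitive_kroneckerChar (k := k) h2
  refine ⟨M, hM0, κ, hM, ?_, hκ, hsq, hprim, LFunction_eq_zero_of_realZero hκ hfac h0 h1 hβ, ?_⟩
  · have h3 := NumberField.abs_discr_gt_two (K := k) (by rw [h2]; exact one_lt_two)
    rw [Int.abs_eq_natAbs] at h3
    rw [hM]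
    exact_mod_cast (show (3 : ℤ) ≤ ((NumberField.discr k).natAbs : ℤ) by omega)
  · have h := LFunction_one_eq_dedekindZeta_residue_of_eq (K := k) hκ
      (fun s hs => hfac (s : ℂ) (by simpa using hs))
    rw [h, Complex.norm_real, Real.norm_eq_abs, abs_of_pos (NumberField.dedekindZeta_residue_pos k)]

end Literature.NumberTheory.QuadraticFields.Quadratic

namespace Literature.NumberTheory.LFunctions.NumberField

open Literature.NumberTheory.GaloisRepresentations Literature.NumberTheory.NumberFields
  Literature.NumberTheory.LFunctions Literature.NumberTheory.QuadraticFields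

/-- **The descent, with the size of `L(1, κ)`.**  There is an absolute `c₂ > 0` such that for every number
field `K` of degree `n > 1`, every real class group character `χ` and every real zero `β` of `L(s, χ)` with
`1 − 1/(8·(2n)!·log|d_K|) ≤ β < 1`, there are `M ≥ 3` with `M^n ∣ |d_K|²` and a primitive quadratic
Dirichlet character `κ ≠ 1` mod `M` with `L(β, κ) = 0` and `c₂/√M ≤ ‖L(1, κ)‖` (`‖L(1,κ)‖ = κ_k ≥ c₂/√|d_k|`
for the quadratic field `k` behind `κ`, `exists_residue_ge_div_sqrt_of_finrank_eq 2`).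
[cite: Stark1974, Thm. 3] [cite: Murty1999StarkZeros, p. 512 (4)] -/
theorem exists_dirichletCharacter_realZero_LOne_ge :
    ∃ c₂ : ℝ, 0 < c₂ ∧ ∀ (K : Type) [Field K] [NumberField K], 1 < finrank ℚ K →
      ∀ χ : ClassGroup (𝓞 K) →* ℂˣ, χ * χ = 1 → ∀ β : ℝ,
        1 - 1 / (8 * ((2 * finrank ℚ K).factorial : ℝ) * Real.log ((discr K).natAbs : ℝ)) ≤ β → β < 1 →
        classGroupLFunction K χ β = 0 →
          ∃ (M : ℕ) (_ : NeZero M) (κ : DirichletCharacter ℂ M), 3 ≤ M ∧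
            M ^ finrank ℚ K ∣ (discr K).natAbs ^ 2 ∧ κ ≠ 1 ∧ κ ^ 2 = 1 ∧ κ.IsPrimitive ∧
            κ.LFunction β = 0 ∧ c₂ / Real.sqrt M ≤ ‖κ.LFunction 1‖ := by
  classical
  obtain ⟨c₂, hc₂, hres⟩ := exists_residue_ge_div_sqrt_of_finrank_eq 2
  refine ⟨c₂, hc₂, fun K _ _ hK χ hχ β hβ hβ1 h0 => ?_⟩
  set n : ℕ := finrank ℚ K with hn
  have hdK : 3 ≤ (discr K).natAbs := three_le_natAbs_discr K hK
  have hd3 : (3 : ℝ) ≤ ((discr K).natAbs : ℝ) := by exact_mod_cast hdK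
  have hlog : 0 < Real.log ((discr K).natAbs : ℝ) := Real.log_pos (by linarith)
  have hne1 : ((β : ℝ) : ℂ) ≠ 1 := by
    intro h; apply hβ1.ne; exact_mod_cast h
  have hβ' : 1 - 1 / (4 * ((n).factorial : ℝ) * Real.log ((discr K).natAbs : ℝ)) ≤ β := by
    have := inv_eight_twoFactorial_le (n := n) hlog
    linarith
  have hk2 : 2 ≤ (n).factorial := by
    have h := Nat.factorial_le (Nat.succ_le_of_lt hK)
    rwa [Nat.factorial_two] at h
  have hβ0 : 0 < β := pos_of_one_sub_inv_log_le hdK hk2 hβ'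
  -- from a quadratic field `k` with `ζ_k(β) = 0`: the character, and `‖L(1,κ)‖ = κ_k ≥ c₂/√M`
  have hquad : ∀ (k : Type) [Field k] [NumberField k] (hk2' : Module.finrank ℚ k = 2),
      dedekindZetaCont k β = 0 →
      ∃ (M : ℕ) (_ : NeZero M) (κ : DirichletCharacter ℂ M), M = (discr k).natAbs ∧ 3 ≤ M ∧
        κ ≠ 1 ∧ κ ^ 2 = 1 ∧ κ.IsPrimitive ∧ κ.LFunction β = 0 ∧ c₂ / Real.sqrt M ≤ ‖κ.LFunction 1‖ := by
    intro k _ _ hk2' hkz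
    obtain ⟨M, hM0, κ, hM, hM3, hκ, hsq, hprim, hLz, hL1⟩ :=
      Quadratic.exists_primitive_LFunction_eq_zero_LOne_eq (k := k) hk2' hβ0 hβ1 hkz
    refine ⟨M, hM0, κ, hM, hM3, hκ, hsq, hprim, hLz, ?_⟩
    rw [hL1]
    have h := hres k hk2'
    have hM' : Real.sqrt |(discr k : ℝ)| = Real.sqrt (M : ℝ) := by
      rw [hM, Nat.cast_natAbs, Int.cast_abs]
    rwa [hM'] at h
  by_cases hχ1 : χ = 1
  · -- `χ = 1`: Stark's Theorem 3 for `K` itself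
    subst hχ1
    rw [classGroupLFunction_one K hne1] at h0
    obtain ⟨k, hk2', hkz⟩ := exists_quadratic_dedekindZetaCont_eq_zero K hK hβ' hβ1 h0
    obtain ⟨M, hM0, κ, hM, hM3, hκ, hsq, hprim, hLz, hL1⟩ :=
      hquad k ((finrank_rat_eq_finrank_rat _ _).trans hk2') hkz
    refine ⟨M, hM0, κ, hM3, ?_, hκ, hsq, hprim, hLz, hL1⟩
    have hdvd : M ^ Module.finrank k K ∣ (discr K).natAbs := by
      rw [hM]; exact natAbs_discr_pow_finrank_dvd k K
    have htower : Module.finrank ℚ k * Module.finrank k K = n := by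
      rw [hn]; exact Module.finrank_mul_finrank ℚ k K
    have hkk : Module.finrank ℚ k = 2 := (finrank_rat_eq_finrank_rat _ _).trans hk2'
    rw [hkk] at htower
    have : M ^ n = (M ^ Module.finrank k K) ^ 2 := by rw [← pow_mul, mul_comm, htower]
    rw [this]
    exact pow_dvd_pow_of_dvd hdvd 2
  · -- `χ ≠ 1`: Stark's Theorem 3 for the quadratic class field `E` of `χ`
    obtain ⟨E, hfd, hgal, h2, hunrAt, hzero⟩ := exists_quadratic_classField_dedekindZetaCont_eq_zero χ hχ hχ1
    haveI := hfd
    haveI := hgal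
    haveI : NumberField E := NumberField.of_module_finite K E
    have hζE : dedekindZetaCont E β = 0 := hzero β hne1 h0
    have hdegE : finrank ℚ E = 2 * n := by
      rw [← Module.finrank_mul_finrank ℚ K E, h2, hn, mul_comm]
    have hdiscE : (discr E).natAbs = (discr K).natAbs ^ 2 := by
      rw [natAbs_discr_eq_pow_of_forall_isUnramifiedAt (K := K) hunrAt, h2]
    have hE1 : 1 < finrank ℚ E := by rw [hdegE]; omega
    have hβE : 1 - 1 / (4 * ((finrank ℚ E).factorial : ℝ) * Real.log ((discr E).natAbs : ℝ)) ≤ β := by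
      rw [hdegE, hdiscE]
      push_cast
      rw [Real.log_pow]
      push_cast
      have : 1 / (4 * ((2 * n).factorial : ℝ) * (2 * Real.log ((discr K).natAbs : ℝ))) =
          1 / (8 * ((2 * n).factorial : ℝ) * Real.log ((discr K).natAbs : ℝ)) := by
        congr 1; ring
      rw [this]
      exact hβ
    obtain ⟨k, hk2', hkz⟩ := exists_quadratic_dedekindZetaCont_eq_zero E hE1 hβE hβ1 hζE
    obtain ⟨M, hM0, κ, hM, hM3, hκ, hsq, hprim, hLz, hL1⟩ :=
      hquad k ((finrank_rat_eq_finrank_rat _ _).trans hk2') hkz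
    refine ⟨M, hM0, κ, hM3, ?_, hκ, hsq, hprim, hLz, hL1⟩
    have hdvd : M ^ Module.finrank k E ∣ (discr E).natAbs := by
      rw [hM]; exact natAbs_discr_pow_finrank_dvd k E
    have htower : Module.finrank ℚ k * Module.finrank k E = 2 * n := by
      rw [← hdegE]
      exact (Module.finrank_mul_finrank ℚ k E).trans (finrank_rat_eq_finrank_rat _ _)
    have hkk : Module.finrank ℚ k = 2 := (finrank_rat_eq_finrank_rat _ _).trans hk2'
    rw [hkk] at htower
    have hkE : Module.finrank k E = n := by omega
    rw [hkE, hdiscE] at hdvd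
    exact hdvd

/-- `√M ≤ d^{1/n}` when `M^n ∣ d²` (`n ≥ 1`, `d ≥ 1`). [folklore] -/
theorem sqrt_le_rpow_inv_of_pow_dvd_sq {M d n : ℕ} (hn : 1 ≤ n) (hd : 1 ≤ d) (h : M ^ n ∣ d ^ 2) :
    Real.sqrt (M : ℝ) ≤ (d : ℝ) ^ ((1 : ℝ) / n) := by
  have hle : (M : ℝ) ^ n ≤ (d : ℝ) ^ 2 := by
    exact_mod_cast Nat.le_of_dvd (by positivity) h
  have hM0 : (0 : ℝ) ≤ M := by positivity
  have hd0 : (0 : ℝ) ≤ d := by positivity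
  have hn0 : (n : ℝ) ≠ 0 := by exact_mod_cast (show n ≠ 0 by omega)
  -- `M = (M^n)^{1/n} ≤ (d²)^{1/n} = d^{2/n}`
  have h1 : (M : ℝ) ≤ (d : ℝ) ^ ((2 : ℝ) / n) := by
    have e1 : ((M : ℝ) ^ n) ^ ((n : ℝ)⁻¹) = M := Real.pow_rpow_inv_natCast hM0 (by omega)
    have e2 : ((d : ℝ) ^ 2) ^ ((n : ℝ)⁻¹) = (d : ℝ) ^ ((2 : ℝ) / n) := by
      rw [show ((d : ℝ) ^ 2) = (d : ℝ) ^ (2 : ℝ) by norm_cast, ← Real.rpow_mul hd0]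
      congr 1
    rw [← e1, ← e2]
    exact Real.rpow_le_rpow (by positivity) hle (by positivity)
  calc Real.sqrt (M : ℝ) ≤ Real.sqrt ((d : ℝ) ^ ((2 : ℝ) / n)) := Real.sqrt_le_sqrt h1
    _ = (d : ℝ) ^ ((1 : ℝ) / n) := by
        rw [Real.sqrt_eq_rpow, ← Real.rpow_mul hd0]
        congr 1; field_simp

/-- **Effective repulsion of the exceptional zero from `1`, every degree (Stark's phenomenon for class
group `L`-functions).**  There is an ABSOLUTE `c > 0` such that for every number field `K` of degree
`n > 1`, every real class group character `χ` (`χ = 1` included) and every real zero `β` of `L(s, χ)` with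
`1 − 1/(8·(2n)!·log|d_K|) ≤ β < 1`:  `c · |d_K|^{−1/n} · (log|d_K|)^{−2} ≤ 1 − β`.  Effective: Montgomery–
Vaughan (11.10) `‖L(1,κ)‖ ≤ C₂(1 − β)(log M)²` for the quadratic character `κ` mod `M ≤ |d_K|^{2/n}` behind
`β`, and `‖L(1,κ)‖ = κ_k ≥ c₂/√M`; outside MV's window `1 − β ≥ c/log 4M`.
[cite: Stark1974, Thm. 3 and §1] [cite: Murty1999StarkZeros, p. 513 (8)–(10)]
[cite: MontgomeryVaughan2007, Theorem 11.4 (11.10)] -/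
theorem classGroupLFunction_one_sub_realZero_ge :
    ∃ c : ℝ, 0 < c ∧ ∀ (K : Type) [Field K] [NumberField K], 1 < finrank ℚ K →
      ∀ χ : ClassGroup (𝓞 K) →* ℂˣ, χ * χ = 1 → ∀ β : ℝ,
        1 - 1 / (8 * ((2 * finrank ℚ K).factorial : ℝ) * Real.log ((discr K).natAbs : ℝ)) ≤ β → β < 1 →
        classGroupLFunction K χ β = 0 →
          c * ((discr K).natAbs : ℝ) ^ (-(1 : ℝ) / finrank ℚ K) / Real.log ((discr K).natAbs : ℝ) ^ 2 ≤
            1 - β := by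
  obtain ⟨c₂, hc₂, hdesc⟩ := exists_dirichletCharacter_realZero_LOne_ge
  obtain ⟨cMV, hcMV, C₁, C₂, hC₁, hC₂, hMV⟩ := MontgomeryVaughan2007_thm11_4_LOne_exceptional_holds
  refine ⟨min (cMV / 3) (c₂ / C₂), lt_min (by positivity) (by positivity),
    fun K _ _ hK χ hχ β hβ hβ1 h0 => ?_⟩
  obtain ⟨M, hM0, κ, hM3, hMdvd, hκ, hsq, -, hLz, hL1⟩ := hdesc K hK χ hχ β hβ hβ1 h0
  set n : ℕ := finrank ℚ K with hn
  set d : ℝ := ((discr K).natAbs : ℝ) with hd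
  have hdK : 3 ≤ (discr K).natAbs := three_le_natAbs_discr K hK
  have hd3 : (3 : ℝ) ≤ d := by rw [hd]; exact_mod_cast hdK
  have hd1 : (1 : ℝ) ≤ d := by linarith
  have hlog3 : 1 < Real.log 3 := by
    rw [← Real.log_exp 1]
    refine Real.log_lt_log (Real.exp_pos 1) ?_
    have := Real.exp_one_lt_d9; linarith
  have hlogd : 1 < Real.log d := hlog3.trans_le (Real.log_le_log (by norm_num) hd3)
  have hlogd0 : 0 < Real.log d := by linarith
  have hM3' : (3 : ℝ) ≤ M := by exact_mod_cast hM3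
  have hlogM : 1 < Real.log (M : ℝ) := hlog3.trans_le (Real.log_le_log (by norm_num) hM3')
  have hMle : M ≤ (discr K).natAbs := le_of_pow_dvd_sq (by omega) (by omega) hMdvd
  have hlogMd : Real.log (M : ℝ) ≤ Real.log d := Real.log_le_log (by linarith) (by rw [hd]; exact_mod_cast hMle)
  -- `d^{-1/n} ≤ 1` and `√M ≤ d^{1/n}`
  have hdn1 : d ^ (-(1 : ℝ) / n) ≤ 1 :=
    Real.rpow_le_one_of_one_le_of_nonpos hd1 (by
      have : (0 : ℝ) < n := by exact_mod_cast (show 0 < n by omega)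
      exact div_nonpos_of_nonpos_of_nonneg (by norm_num) this.le)
  have hdn0 : 0 < d ^ (-(1 : ℝ) / n) := Real.rpow_pos_of_pos (by linarith) _
  have hsqrtM : Real.sqrt (M : ℝ) ≤ d ^ ((1 : ℝ) / n) := by
    rw [hd]; exact sqrt_le_rpow_inv_of_pow_dvd_sq (by omega) (by omega) hMdvd
  have hsqrtM0 : 0 < Real.sqrt (M : ℝ) := Real.sqrt_pos.mpr (by linarith)
  have hinv : d ^ (-(1 : ℝ) / n) = (d ^ ((1 : ℝ) / n))⁻¹ := by
    rw [← Real.rpow_neg (by linarith)]; congr 1; ring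
  -- the target constant is at most each of the two case constants
  have hmin1 : min (cMV / 3) (c₂ / C₂) ≤ cMV / 3 := min_le_left _ _
  have hmin2 : min (cMV / 3) (c₂ / C₂) ≤ c₂ / C₂ := min_le_right _ _
  have hminpos : 0 < min (cMV / 3) (c₂ / C₂) := lt_min (by positivity) (by positivity)
  have hlog2 : Real.log d ≤ Real.log d ^ 2 := by nlinarith
  rcases le_or_gt β (1 - cMV / Real.log (4 * M)) with hout | hin
  · -- outside Montgomery–Vaughan's window: `1 − β ≥ cMV/log 4M ≥ cMV/(3 log d)`
    have h4M : Real.log (4 * (M : ℝ)) ≤ 3 * Real.log (M : ℝ) := log_four_mul_le_three_mul_log (by linarith)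
    have hlog4M : 0 < Real.log (4 * (M : ℝ)) := Real.log_pos (by linarith)
    have h1 : cMV / (3 * Real.log d) ≤ cMV / Real.log (4 * M) :=
      div_le_div_of_nonneg_left hcMV.le hlog4M (by linarith)
    have h2 : min (cMV / 3) (c₂ / C₂) * d ^ (-(1 : ℝ) / n) / Real.log d ^ 2 ≤ cMV / (3 * Real.log d) := by
      rw [div_le_div_iff₀ (by positivity) (by positivity)]
      calc min (cMV / 3) (c₂ / C₂) * d ^ (-(1 : ℝ) / n) * (3 * Real.log d)
          ≤ (cMV / 3) * 1 * (3 * Real.log d) := by gcongr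
        _ = cMV * Real.log d := by ring
        _ ≤ cMV * Real.log d ^ 2 := by gcongr
    linarith
  · -- inside: MV (11.10) `‖L(1,κ)‖ ≤ C₂ (1−β) (log M)²` and `‖L(1,κ)‖ ≥ c₂/√M`
    obtain ⟨-, hup⟩ := hMV M κ hκ (MulChar.isQuadratic_iff_sq_eq_one.mpr hsq) β hin hβ1 hLz
    have hchain : c₂ / Real.sqrt M ≤ C₂ * (1 - β) * Real.log (M : ℝ) ^ 2 := hL1.trans hup
    -- `c₂/√M ≥ c₂ d^{−1/n}`, `(log M)² ≤ (log d)²`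
    have h1β : 0 ≤ 1 - β := by linarith
    have hlogM2 : Real.log (M : ℝ) ^ 2 ≤ Real.log d ^ 2 := by gcongr
    have h3 : c₂ * d ^ (-(1 : ℝ) / n) ≤ c₂ / Real.sqrt M := by
      rw [hinv, ← div_eq_mul_inv]
      exact div_le_div_of_nonneg_left hc₂.le hsqrtM0 hsqrtM
    have h4 : C₂ * (1 - β) * Real.log (M : ℝ) ^ 2 ≤ C₂ * (1 - β) * Real.log d ^ 2 := by gcongr
    have h5 : c₂ * d ^ (-(1 : ℝ) / n) ≤ C₂ * (1 - β) * Real.log d ^ 2 := (h3.trans hchain).trans h4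
    rw [div_le_iff₀ (by positivity)]
    calc min (cMV / 3) (c₂ / C₂) * d ^ (-(1 : ℝ) / n) ≤ (c₂ / C₂) * d ^ (-(1 : ℝ) / n) := by gcongr
      _ = (c₂ * d ^ (-(1 : ℝ) / n)) / C₂ := by ring
      _ ≤ (C₂ * (1 - β) * Real.log d ^ 2) / C₂ := div_le_div_of_nonneg_right h5 hC₂.le
      _ = (1 - β) * Real.log d ^ 2 := by field_simp

/-- **Every real zero of a real class group `L`-function, effective bound** (no window): with the absolute
`c` of `classGroupLFunction_one_sub_realZero_ge`, for `K` of degree `n > 1`, `χ² = 1` and a real zero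
`β < 1`:  `min (1/(8(2n)! log|d_K|)) (c·|d_K|^{−1/n}(log|d_K|)^{−2}) ≤ 1 − β`. [cite: Stark1974, §1] -/
theorem classGroupLFunction_one_sub_realZero_ge' :
    ∃ c : ℝ, 0 < c ∧ ∀ (K : Type) [Field K] [NumberField K], 1 < finrank ℚ K →
      ∀ χ : ClassGroup (𝓞 K) →* ℂˣ, χ * χ = 1 → ∀ β : ℝ, β < 1 → classGroupLFunction K χ β = 0 →
        min (1 / (8 * ((2 * finrank ℚ K).factorial : ℝ) * Real.log ((discr K).natAbs : ℝ)))
          (c * ((discr K).natAbs : ℝ) ^ (-(1 : ℝ) / finrank ℚ K) / Real.log ((discr K).natAbs : ℝ) ^ 2) ≤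
          1 - β := by
  obtain ⟨c, hc, h⟩ := classGroupLFunction_one_sub_realZero_ge
  refine ⟨c, hc, fun K _ _ hK χ hχ β hβ1 h0 => ?_⟩
  rcases lt_or_ge β (1 - 1 / (8 * ((2 * finrank ℚ K).factorial : ℝ) * Real.log ((discr K).natAbs : ℝ)))
    with hout | hin
  · exact (min_le_left _ _).trans (by linarith)
  · exact (min_le_right _ _).trans (h K hK χ hχ β hin hβ1 h0)

end Literature.NumberTheory.LFunctions.NumberField

end
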